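/-
Soloist `solo-ValiantsHypothesis-informed`, session 22 — the product trick: the only bound on the
univariate quantity `Q_{K,h}(s)` of Conjecture Q* that is uniform in the product rank, the support
and the height; it saves a constant factor over the trivial bound and no more.  First inhabitant of
the hypothesis-carrying structure `SoloQuadSpanBound` in the tree.
-/
import Mathlib
import Summits.ValiantsHypothesis.ValiantsHypothesis.Theorems.SoloInformedQuadSpanReduction
import Summits.ValiantsHypothesis.ValiantsHypothesis.Theorems.SoloInformedSupportDoubling

/-!
# The product trick: `C(|E|, k) ≤ C(s + 2k, 2k)`, and `SoloQuadSpanBound (2k) h` is inhabited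

Setting of Conjecture Q* (soloist note `paper/quadspan.md` §2.5; this is §7.16, Proposition 7.72):
`b : Fin s → R` are `s` elements of a commutative algebra `R` over a field `F`, `χ : ℕ → R` is a
multiplicative, `F`-linearly independent system of "monomials" (`χ (x + y) = χ x * χ y`, `χ 0 = 1`;
in Q*: `R = Ω ⊇ ℂ(z)` algebraic functions and `χ e = z ^ e`), and `E ⊂ ℕ` is `(2k, h)`-free, `h ≥ 1`
(no nontrivial integer relation with `≤ 2k` nonzero coefficients of absolute value `≤ h` — the
convention of `SoloQuadSpanBound`), with every `χ e`, `e ∈ E`, of the form `Γ_e(b)`, `deg Γ_e ≤ 2`.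

Then the `k`-fold products `∏_{e ∈ S} χ e = χ (∑ S)` over the `k`-subsets `S ⊆ E` are pairwise
distinct monomials — freeness makes `S ↦ ∑ S` injective (`soloInformed_kSubsetSums_injOn`, s21) —
hence linearly independent, and all of them are values at `b` of polynomials of degree `≤ 2k`, a
space of dimension `≤ C(s + 2k, 2k)` (stars and bars).  Hence

* `soloInformed_productTrick`      : `C(|E|, k) ≤ C(s + 2k, 2k)` (abstract form, any `F`, `R`, `χ`);
* `solo_linearIndependent_soloZ_pow` : the powers of `z` in `Ω = SoloΩ` are `ℂ`-linearly independent;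
* `soloInformed_quadSpanBound_productTrick` : for `k ≥ 1`, `h ≥ 1` an element of
  `SoloQuadSpanBound (2k) h` with `Q s :=` the largest `N ≤ C(s+2k,2k) + k` with `C(N,k) ≤ C(s+2k,2k)`;
  `soloInformed_nonempty_quadSpanBound` : `SoloQuadSpanBound K h` is inhabited for `K ≥ 2`, `h ≥ 1`
  (the structure had no inhabitant in the tree before; nothing here is credited toward the summit:
  the reduction `soloInformed_vp_ne_vnp_of_quadSpanBound_cor58` needs `Q s ≤ C s^γ`, `γ < 3/2`).

Size: `C(s+2k,2k)/C(N,k) → (k!/(2k)!)·(s²/N)^k`, so the bound reads `|E| ≤ ((k!/(2k)!)^{1/k} + o(1)) s²`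
(`≈ 0.203 s²` for `k = 3`) against the trivial `C(s+2,2) ≈ s²/2`: a constant factor.  As recorded in
the note (rung R0 of §7.16), NO bound `Q_{K,h}(s) ≤ s^{2-δ}` is known for any `K, h`.
-/

noncomputable section

namespace Summit.ValiantsHypothesis.ValiantsHypothesis.Theorems

open Finset MvPolynomial
open scoped Pointwise

/-! ### Freeness over `ℕ` (the `SoloQuadSpanBound` convention) versus `SoloFree` over `ℤ` -/

/-- Height monotonicity of `SoloFree`. -/
theorem soloFree_of_le_height {G : Type*} [AddCommGroup G] [DecidableEq G] {K h h' : ℕ}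
    (hle : h' ≤ h) {E : Finset G} (hE : SoloFree K h E) : SoloFree K h' E := by
  intro c hsupp hht hsum
  exact hE c hsupp (fun e => (hht e).trans (by exact_mod_cast hle)) hsum

/-- `(K, h)`-freeness of `E ⊂ ℕ` in the sense of `SoloQuadSpanBound` gives `SoloFree K h` of its
image in `ℤ`. -/
theorem soloFree_map_natCast {K h : ℕ} (E : Finset ℕ)
    (hfree : ∀ c : ℕ → ℤ, (E.filter fun e => c e ≠ 0).card ≤ K → (∀ e, |c e| ≤ h) →
      (∑ e ∈ E, c e * (e : ℤ)) = 0 → ∀ e ∈ E, c e = 0) :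
    SoloFree K h (E.map (Nat.castEmbedding : ℕ ↪ ℤ)) := by
  intro c hsupp hht hsum x hx
  obtain ⟨e, he, rfl⟩ := Finset.mem_map.mp hx
  have hsupp' : (E.filter fun n : ℕ => c (n : ℤ) ≠ 0).card ≤ K := by
    have hsub : (E.filter fun n : ℕ => c (n : ℤ) ≠ 0).map (Nat.castEmbedding : ℕ ↪ ℤ) ⊆
        (E.map (Nat.castEmbedding : ℕ ↪ ℤ)).filter fun x => c x ≠ 0 := by
      intro x hx'
      obtain ⟨n, hn, rfl⟩ := Finset.mem_map.mp hx'
      rw [Finset.mem_filter] at hn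
      rw [Finset.mem_filter]
      exact ⟨Finset.mem_map_of_mem _ hn.1, by simpa [Nat.castEmbedding] using hn.2⟩
    rw [← Finset.card_map (Nat.castEmbedding : ℕ ↪ ℤ)]
    exact (Finset.card_le_card hsub).trans hsupp
  have hsum' : (∑ n ∈ E, c ((n : ℕ) : ℤ) * ((n : ℕ) : ℤ)) = 0 := by
    rw [Finset.sum_map] at hsum
    simpa [smul_eq_mul, Nat.castEmbedding] using hsum
  have key := hfree (fun n : ℕ => c (n : ℤ)) hsupp' (fun n => hht n) hsum' e he
  simpa [Nat.castEmbedding] using key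

/-- Freeness to order `2k` (any height `h ≥ 1`) makes `S ↦ ∑_{e ∈ S} e` injective on the
`k`-subsets of `E ⊂ ℕ`. -/
theorem solo_kSubsetSums_injOn_nat (k h : ℕ) (hh : 1 ≤ h) (E : Finset ℕ)
    (hfree : ∀ c : ℕ → ℤ, (E.filter fun e => c e ≠ 0).card ≤ 2 * k → (∀ e, |c e| ≤ h) →
      (∑ e ∈ E, c e * (e : ℤ)) = 0 → ∀ e ∈ E, c e = 0) :
    Set.InjOn (fun S : Finset ℕ => ∑ e ∈ S, e) (E.powersetCard k : Set (Finset ℕ)) := by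
  set ι : ℕ ↪ ℤ := Nat.castEmbedding with hι
  have hZ : SoloFree (2 * k) 1 (E.map ι) :=
    soloFree_of_le_height hh (soloFree_map_natCast E hfree)
  have hinj := soloInformed_kSubsetSums_injOn k (E.map ι) hZ
  intro S hS T hT hST
  simp only [mem_coe, mem_powersetCard] at hS hT
  have hS' : S.map ι ∈ ((E.map ι).powersetCard k : Set (Finset ℤ)) := by
    rw [mem_coe, mem_powersetCard, card_map]
    exact ⟨map_subset_map.mpr hS.1, hS.2⟩
  have hT' : T.map ι ∈ ((E.map ι).powersetCard k : Set (Finset ℤ)) := by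
    rw [mem_coe, mem_powersetCard, card_map]
    exact ⟨map_subset_map.mpr hT.1, hT.2⟩
  have hsum : (∑ x ∈ S.map ι, x) = ∑ x ∈ T.map ι, x := by
    rw [Finset.sum_map, Finset.sum_map]
    have h := congrArg (fun m : ℕ => (m : ℤ)) hST
    simpa [hι, Nat.castEmbedding, Nat.cast_sum] using h
  exact Finset.map_injective ι (hinj hS' hT' hsum)

/-! ### Values of polynomials of bounded degree -/

section DegSpan

variable {F : Type*} [Field F] {R : Type*} [CommRing R] [Algebra F R] {s : ℕ}

/-- The values at `b` of the polynomials of total degree `≤ n`. -/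
def soloDegSpan (b : Fin s → R) (n : ℕ) : Submodule F R :=
  (restrictTotalDegree (Fin s) F n).map (MvPolynomial.aeval b).toLinearMap

/-- Values of polynomials of degree `≤ n` lie in `soloDegSpan b n`. -/
theorem mem_soloDegSpan_of_aeval (b : Fin s → R) {n : ℕ} {x : R}
    (hx : ∃ Γ : MvPolynomial (Fin s) F, Γ.totalDegree ≤ n ∧ aeval b Γ = x) :
    x ∈ soloDegSpan (F := F) b n := by
  obtain ⟨Γ, hdeg, rfl⟩ := hx
  exact Submodule.mem_map.mpr ⟨Γ, (mem_restrictTotalDegree _ _ _).mpr hdeg, rfl⟩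

/-- `1` is the value of a polynomial of degree `0`. -/
theorem one_mem_soloDegSpan (b : Fin s → R) : (1 : R) ∈ soloDegSpan (F := F) b 0 :=
  mem_soloDegSpan_of_aeval b ⟨1, by simp, by simp⟩

/-- `soloDegSpan b a * soloDegSpan b c ⊆ soloDegSpan b (a + c)` (degrees add). -/
theorem mul_mem_soloDegSpan (b : Fin s → R) {a c : ℕ} {x y : R}
    (hx : x ∈ soloDegSpan (F := F) b a) (hy : y ∈ soloDegSpan (F := F) b c) :
    x * y ∈ soloDegSpan (F := F) b (a + c) := by
  obtain ⟨Γ₁, h₁, rfl⟩ := Submodule.mem_map.mp hx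
  obtain ⟨Γ₂, h₂, rfl⟩ := Submodule.mem_map.mp hy
  rw [mem_restrictTotalDegree] at h₁ h₂
  refine mem_soloDegSpan_of_aeval b ⟨Γ₁ * Γ₂, ?_, by simp⟩
  exact (totalDegree_mul Γ₁ Γ₂).trans (add_le_add h₁ h₂)

/-- A product of `|S|` values of quadratic polynomials is the value of a polynomial of degree
`≤ 2|S|`. -/
theorem prod_mem_soloDegSpan {ι : Type*} [DecidableEq ι] (b : Fin s → R) (f : ι → R) (S : Finset ι)
    (hf : ∀ i ∈ S, f i ∈ soloDegSpan (F := F) b 2) :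
    (∏ i ∈ S, f i) ∈ soloDegSpan (F := F) b (2 * S.card) := by
  induction S using Finset.induction_on with
  | empty => simpa using one_mem_soloDegSpan (F := F) b
  | insert a S ha ih =>
    rw [prod_insert ha, card_insert_of_notMem ha]
    have h := mul_mem_soloDegSpan b (hf a (mem_insert_self a S))
      (ih fun i hi => hf i (mem_insert_of_mem hi))
    have harith : 2 * (S.card + 1) = 2 + 2 * S.card := by ring
    rw [harith]
    exact h

/-- Stars and bars: `dim_F F[y_1, …, y_s]_{≤ n} ≤ C(s + n, n)` (pad a monomial of degree `≤ n` with
a slack variable to a multiset of size exactly `n` over `Option (Fin s)`; cf. the degree-`2` case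
`solo_finrank_restrictTotalDegree_two_le`). -/
theorem solo_finrank_restrictTotalDegree_le (F : Type*) [Field F] (s n : ℕ) :
    Module.finrank F (restrictTotalDegree (Fin s) F n) ≤ Nat.choose (s + n) n := by
  classical
  let T : Set (Fin s →₀ ℕ) := {μ | (μ.sum fun _ e => e) ≤ n}
  have hfr : Module.finrank F (restrictTotalDegree (Fin s) F n) = Nat.card T :=
    Module.finrank_eq_nat_card_basis (basisRestrictSupport F T)
  have hdeg : ∀ μ : T, Multiset.card (Finsupp.toMultiset μ.1) ≤ n := by
    intro μ
    rw [Finsupp.card_toMultiset]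
    exact μ.2
  let pad : T → Sym (Option (Fin s)) n := fun μ =>
    Sym.mk ((Finsupp.toMultiset μ.1).map some + Multiset.replicate (n - Multiset.card
      (Finsupp.toMultiset μ.1)) none) (by
        rw [Multiset.card_add, Multiset.card_map, Multiset.card_replicate]
        have := hdeg μ
        omega)
  have hrep : ∀ k, Multiset.filterMap id (Multiset.replicate k (none : Option (Fin s))) = 0 := by
    intro k
    induction k with
    | zero => simp
    | succ k ih => rw [Multiset.replicate_succ, Multiset.filterMap_cons_none _ _ rfl, ih]
  have hback : ∀ μ : T, Multiset.filterMap id ((pad μ : Sym (Option (Fin s)) n) : Multiset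
      (Option (Fin s))) = Finsupp.toMultiset μ.1 := by
    intro μ
    simp only [pad, Sym.coe_mk, Multiset.filterMap_add, Multiset.filterMap_map, hrep, add_zero]
    exact Multiset.filterMap_some _
  have hinj : Function.Injective pad := by
    intro μ μ' hμ
    have h1 := hback μ
    rw [hμ, hback μ'] at h1
    apply Subtype.ext
    have h2 := congr_arg Multiset.toFinsupp h1
    simpa [Finsupp.toMultiset_toFinsupp] using h2.symm
  have hcard := Nat.card_le_card_of_injective pad hinj
  rw [Nat.card_eq_fintype_card (α := Sym (Option (Fin s)) n), Sym.card_sym_eq_choose,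
    Fintype.card_option, Fintype.card_fin, show s + 1 + n - 1 = s + n by omega] at hcard
  rw [hfr]
  exact hcard

/-- `dim soloDegSpan b n ≤ C(s + n, n)`. -/
theorem finrank_soloDegSpan_le (b : Fin s → R) (n : ℕ) :
    Module.finrank F (soloDegSpan (F := F) b n) ≤ Nat.choose (s + n) n :=
  (Submodule.finrank_map_le _ _).trans (solo_finrank_restrictTotalDegree_le F s n)

end DegSpan

/-! ### The product trick -/

/-- A multiplicative system of monomials turns sums into products. -/
theorem solo_chi_sum {R : Type*} [CommRing R] (χ : ℕ → R) (h0 : χ 0 = 1)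
    (hmul : ∀ x y, χ (x + y) = χ x * χ y) (S : Finset ℕ) :
    χ (∑ e ∈ S, e) = ∏ e ∈ S, χ e := by
  induction S using Finset.induction_on with
  | empty => simpa using h0
  | insert a S ha ih => rw [sum_insert ha, prod_insert ha, hmul, ih]

/-- **The product trick (Proposition 7.72 of the note).**  If `E ⊂ ℕ` is `(2k, h)`-free, `h ≥ 1`,
and every monomial `χ e`, `e ∈ E`, is the value at `b : Fin s → R` of a polynomial of degree `≤ 2`,
then `C(|E|, k) ≤ C(s + 2k, 2k)`. -/
theorem soloInformed_productTrick {F : Type*} [Field F] {R : Type*} [CommRing R] [Algebra F R]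
    {s : ℕ} (b : Fin s → R) (χ : ℕ → R) (h0 : χ 0 = 1) (hmul : ∀ x y, χ (x + y) = χ x * χ y)
    (hli : LinearIndependent F χ) (k h : ℕ) (hh : 1 ≤ h) (E : Finset ℕ)
    (hfree : ∀ c : ℕ → ℤ, (E.filter fun e => c e ≠ 0).card ≤ 2 * k → (∀ e, |c e| ≤ h) →
      (∑ e ∈ E, c e * (e : ℤ)) = 0 → ∀ e ∈ E, c e = 0)
    (hE : ∀ e ∈ E, ∃ Γ : MvPolynomial (Fin s) F, Γ.totalDegree ≤ 2 ∧ aeval b Γ = χ e) :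
    (E.card).choose k ≤ (s + 2 * k).choose (2 * k) := by
  classical
  -- the family of `k`-fold products, indexed by the `k`-subsets of `E`
  let σ : ↥(E.powersetCard k) → ℕ := fun S => ∑ e ∈ (S : Finset ℕ), e
  have hinj : Function.Injective σ := by
    intro S T hST
    exact Subtype.ext (solo_kSubsetSums_injOn_nat k h hh E hfree (Finset.mem_coe.mpr S.2)
      (Finset.mem_coe.mpr T.2) hST)
  have hliΦ : LinearIndependent F (χ ∘ σ) := hli.comp σ hinj
  -- every member of the family is the value of a polynomial of degree `≤ 2k`
  haveI : Module.Finite F (soloDegSpan (F := F) b (2 * k)) := by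
    unfold soloDegSpan; infer_instance
  set P := soloDegSpan (F := F) b (2 * k) with hP
  have hmem : ∀ S : ↥(E.powersetCard k), (χ ∘ σ) S ∈ P := by
    intro S
    have hS : (S : Finset ℕ) ∈ E.powersetCard k := S.2
    rw [mem_powersetCard] at hS
    simp only [Function.comp_apply, σ]
    rw [solo_chi_sum χ h0 hmul, hP]
    have h := prod_mem_soloDegSpan (F := F) b χ (S : Finset ℕ)
      (fun e he => mem_soloDegSpan_of_aeval b (hE e (hS.1 he)))
    rw [hS.2] at h
    exact h
  let Φ : ↥(E.powersetCard k) → P := fun S => ⟨(χ ∘ σ) S, hmem S⟩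
  have hliP : LinearIndependent F Φ := by
    apply LinearIndependent.of_comp P.subtype
    exact hliΦ
  have h1 : Fintype.card ↥(E.powersetCard k) ≤ Module.finrank F P := hliP.fintype_card_le_finrank
  have h2 : Module.finrank F P ≤ (s + 2 * k).choose (2 * k) := finrank_soloDegSpan_le b (2 * k)
  have h4 : Fintype.card ↥(E.powersetCard k) = (E.card).choose k := by
    rw [Fintype.card_coe, card_powersetCard]
  omega

/-! ### The curve model: powers of `z` in `SoloΩ` -/

/-- `ℂ[z] → Ω` is injective (`Ω` an algebraic closure of `Frac ℂ[z]`). -/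
theorem solo_algebraMap_soloΩ_injective :
    Function.Injective (algebraMap (MvPolynomial (Fin 1) ℂ) SoloΩ) := by
  rw [IsScalarTower.algebraMap_eq (MvPolynomial (Fin 1) ℂ)
    (FractionRing (MvPolynomial (Fin 1) ℂ)) SoloΩ]
  exact (algebraMap (FractionRing (MvPolynomial (Fin 1) ℂ)) SoloΩ).injective.comp
    (IsFractionRing.injective (MvPolynomial (Fin 1) ℂ) (FractionRing (MvPolynomial (Fin 1) ℂ)))

/-- The powers `z ^ n`, `n ∈ ℕ`, of the variable in `Ω` are `ℂ`-linearly independent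
(`z` is transcendental over `ℂ`). -/
theorem solo_linearIndependent_soloZ_pow : LinearIndependent ℂ (fun n : ℕ => soloZ ^ n) := by
  -- the monomials `X 0 ^ n` are linearly independent in `ℂ[z]`
  have hmono : LinearIndependent ℂ (fun n : ℕ => (X 0 : MvPolynomial (Fin 1) ℂ) ^ n) := by
    have hb := (MvPolynomial.basisMonomials (Fin 1) ℂ).linearIndependent
    have hcomp := hb.comp (fun n : ℕ => Finsupp.single (0 : Fin 1) n)
      (Finsupp.single_injective (0 : Fin 1))
    have hfun : (fun n : ℕ => (X 0 : MvPolynomial (Fin 1) ℂ) ^ n) =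
        ⇑(MvPolynomial.basisMonomials (Fin 1) ℂ) ∘ fun n : ℕ => Finsupp.single (0 : Fin 1) n := by
      funext n
      simp [MvPolynomial.coe_basisMonomials, X_pow_eq_monomial]
    rw [hfun]
    exact hcomp
  -- transport along the injective algebra map `ℂ[z] → Ω`
  let φ : MvPolynomial (Fin 1) ℂ →ₐ[ℂ] SoloΩ := IsScalarTower.toAlgHom ℂ (MvPolynomial (Fin 1) ℂ) SoloΩ
  have hker : LinearMap.ker φ.toLinearMap = ⊥ := by
    apply LinearMap.ker_eq_bot.mpr
    intro x y hxy
    exact solo_algebraMap_soloΩ_injective hxy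
  have h := hmono.map' φ.toLinearMap hker
  have hfun : (fun n : ℕ => soloZ ^ n) = ⇑φ.toLinearMap ∘ fun n : ℕ => (X 0 : MvPolynomial (Fin 1) ℂ) ^ n := by
    funext n
    simp [φ, soloZ, map_pow]
  rw [hfun]
  exact h

/-! ### `SoloQuadSpanBound (2k) h` is inhabited -/

/-- `N ≤ C(N, k) + k` for `k ≥ 1`. -/
theorem solo_le_choose_add (N k : ℕ) (hk : 1 ≤ k) : N ≤ N.choose k + k := by
  obtain ⟨k, rfl⟩ : ∃ k', k = k' + 1 := ⟨k - 1, by omega⟩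
  clear hk
  by_cases hN : N < k + 1
  · omega
  · obtain ⟨j, rfl⟩ : ∃ j, N = k + 1 + j := ⟨N - (k + 1), by omega⟩
    have key : ∀ j, j + 1 ≤ (k + 1 + j).choose (k + 1) := by
      intro j
      induction j with
      | zero => simp
      | succ j ih =>
        rw [show k + 1 + (j + 1) = (k + 1 + j) + 1 by ring, Nat.choose_succ_succ']
        have hpos : 0 < (k + 1 + j).choose k := Nat.choose_pos (by omega)
        omega
    have := key j
    omega

/-- The product-trick bound in the hypothesis format of `SoloQuadSpanBound`:
`C(|E|, k) ≤ C(s + 2k, 2k)` for `(2k, h)`-free `E`, `h ≥ 1`, realised in the quadratic span of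
`s` algebraic functions. -/
theorem soloInformed_productTrick_soloΩ (k h : ℕ) (hh : 1 ≤ h) (s : ℕ) (b : Fin s → SoloΩ)
    (E : Finset ℕ)
    (hfree : ∀ c : ℕ → ℤ, (E.filter fun e => c e ≠ 0).card ≤ 2 * k → (∀ e, |c e| ≤ h) →
      (∑ e ∈ E, c e * (e : ℤ)) = 0 → ∀ e ∈ E, c e = 0)
    (hE : ∀ e ∈ E, ∃ Γ : MvPolynomial (Fin s) ℂ, Γ.totalDegree ≤ 2 ∧ aeval b Γ = soloZ ^ e) :
    (E.card).choose k ≤ (s + 2 * k).choose (2 * k) :=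
  soloInformed_productTrick b (fun n => soloZ ^ n) (pow_zero _) (fun _ _ => pow_add _ _ _)
    solo_linearIndependent_soloZ_pow k h hh E hfree hE

/-- **`SoloQuadSpanBound (2k) h` is inhabited by the product-trick bound** (`k ≥ 1`, `h ≥ 1`):
`Q s :=` the largest `N ≤ C(s+2k,2k) + k` with `C(N, k) ≤ C(s+2k, 2k)` — asymptotically
`((k!/(2k)!)^{1/k} + o(1)) s²`.  This is NOT the bound Conjecture Q* asks for (`C s^γ`, `γ < 3/2`). -/
def soloInformed_quadSpanBound_productTrick (k h : ℕ) (hk : 1 ≤ k) (hh : 1 ≤ h) :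
    SoloQuadSpanBound (2 * k) h where
  Q s := Nat.findGreatest (fun N => N.choose k ≤ (s + 2 * k).choose (2 * k))
    ((s + 2 * k).choose (2 * k) + k)
  bound s b E hfree hΓ := by
    have h1 := soloInformed_productTrick_soloΩ k h hh s b E hfree hΓ
    have h2 : E.card ≤ (s + 2 * k).choose (2 * k) + k :=
      (solo_le_choose_add E.card k hk).trans (by omega)
    exact Nat.le_findGreatest h2 h1

/-- `SoloQuadSpanBound K h` is inhabited for every `K ≥ 2`, `h ≥ 1` (freeness to order `K` implies
freeness to order `2 ⌊K/2⌋`). -/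
theorem soloInformed_nonempty_quadSpanBound {K h : ℕ} (hK : 2 ≤ K) (hh : 1 ≤ h) :
    Nonempty (SoloQuadSpanBound K h) := by
  refine ⟨⟨(soloInformed_quadSpanBound_productTrick (K / 2) h (by omega) hh).Q, ?_⟩⟩
  intro s b E hfree hΓ
  refine (soloInformed_quadSpanBound_productTrick (K / 2) h (by omega) hh).bound s b E ?_ hΓ
  intro c hsupp hht hsum
  exact hfree c (hsupp.trans (by omega)) hht hsum

end Summit.ValiantsHypothesis.ValiantsHypothesis.Theorems

end
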